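import Mathlib.LinearAlgebra.FiniteDimensional.Defs
import Mathlib.LinearAlgebra.Dimension.Finrank
import Mathlib.Data.Fintype.Order
import Literature.Computability.AlgebraicComplexity.StandardFamilies

/-!
# Route LiftNullstellensatz — `LiftWidthPerFour` (item stmt-ValiantsHypothesis-5922): linear spaces
on the permanental hypersurface, step F1 (reduced echelon bases)

Every linear subspace `W` of `K^ι` (`ι` a finite linear order — for us the cells of a `4 × 4`
matrix in row-major order) has a REDUCED ECHELON BASIS: a set `S` of "leading cells" and vectors
`A_c ∈ W` (`c ∈ S`) with `A_c(c) = 1`, `A_c(c') = 0` for the other leading cells `c'`,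
`A_c(p) = 0` for `p < c`, and `w = Σ_{c ∈ S} w(c) A_c` for every `w ∈ W`
(`exists_echelon_basis`; Gaussian elimination, by induction on the allowed support).  This is the
bookkeeping behind `𝔟(W)` in Guterman–Meshulam–Spiridonov, arXiv:2212.11193, §2.  No new
definitions.
-/

namespace Summit.ValiantsHypothesis.LiftNullstellensatz

variable {K : Type*} [Field K] {ι : Type*} [LinearOrder ι]

/-- **Reduced echelon basis with prescribed support** (induction form): if every vector of `W`
is supported in the finite set `T`, then `W` has a reduced echelon basis with leading cells in
`T`. [folklore] -/
theorem exists_echelon_basis_of_support (T : Finset ι) :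
    ∀ (W : Submodule K (ι → K)), (∀ w ∈ W, ∀ q, q ∉ T → w q = 0) →
    ∃ (S : Finset ι) (A : ι → (ι → K)), S ⊆ T ∧ (∀ c ∈ S, A c ∈ W) ∧ (∀ c ∈ S, A c c = 1) ∧
      (∀ c ∈ S, ∀ c' ∈ S, c' ≠ c → A c c' = 0) ∧ (∀ c ∈ S, ∀ p, p < c → A c p = 0) ∧
      (∀ w ∈ W, w = ∑ c ∈ S, w c • A c) := by
  classical
  induction T using Finset.strongInduction with
  | H T ih =>
    intro W hW
    by_cases hbot : ∀ w ∈ W, w = 0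
    · refine ⟨∅, fun _ => 0, Finset.empty_subset _, by simp, by simp, by simp, by simp, ?_⟩
      intro w hw; simp [hbot w hw]
    push Not at hbot
    -- the smallest cell carrying a nonzero value of some vector of `W`
    have hne : (T.filter fun q => ∃ w ∈ W, w q ≠ 0).Nonempty := by
      obtain ⟨w, hw, hw0⟩ := hbot
      obtain ⟨q, hq⟩ : ∃ q, w q ≠ 0 := by
        by_contra h; push Not at h; exact hw0 (funext h)
      exact ⟨q, Finset.mem_filter.2 ⟨by_contra fun hqT => hq (hW w hw q hqT), w, hw, hq⟩⟩
    set p := (T.filter fun q => ∃ w ∈ W, w q ≠ 0).min' hne with hp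
    have hpmem := Finset.min'_mem _ hne
    rw [← hp, Finset.mem_filter] at hpmem
    obtain ⟨hpT, w₀', hw₀', hw₀'p⟩ := hpmem
    -- everything in `W` vanishes below `p`
    have hbelow : ∀ w ∈ W, ∀ q, q < p → w q = 0 := by
      intro w hw q hq
      by_contra hwq
      have hqT : q ∈ T := by by_contra hqT; exact hwq (hW w hw q hqT)
      have : p ≤ q := Finset.min'_le _ _ (Finset.mem_filter.2 ⟨hqT, w, hw, hwq⟩)
      exact absurd hq (not_lt.2 this)
    -- normalise `w₀ p = 1`
    set w₀ : ι → K := (w₀' p)⁻¹ • w₀' with hw₀def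
    have hw₀ : w₀ ∈ W := W.smul_mem _ hw₀'
    have hw₀p : w₀ p = 1 := by simp [hw₀def, hw₀'p]
    -- the subspace `W' = {w ∈ W | w p = 0}`, supported in `T.erase p`
    let W' : Submodule K (ι → K) := W ⊓ LinearMap.ker (LinearMap.proj p)
    have hW'le : W' ≤ W := inf_le_left
    have hW'p : ∀ w ∈ W', w p = 0 := fun w hw => by
      have h2 := (Submodule.mem_inf.1 hw).2
      rw [LinearMap.mem_ker, LinearMap.proj_apply] at h2
      exact h2
    have hW'supp : ∀ w ∈ W', ∀ q, q ∉ T.erase p → w q = 0 := by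
      intro w hw q hq
      rw [Finset.mem_erase, not_and_or, not_ne_iff] at hq
      rcases hq with rfl | hq
      · exact hW'p w hw
      · exact hW w (hW'le hw) q hq
    obtain ⟨S', A', hS'T, hA'W, hA'1, hA'0, hA'lt, hA'rep⟩ :=
      ih (T.erase p) (Finset.erase_ssubset hpT) W' hW'supp
    have hpS' : p ∉ S' := fun h => Finset.notMem_erase p T (hS'T h)
    -- the new basis vector at `p`
    set Ap : ι → K := w₀ - ∑ c ∈ S', w₀ c • A' c with hAp
    refine ⟨insert p S', fun c => if c = p then Ap else A' c, ?_, ?_, ?_, ?_, ?_, ?_⟩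
    · exact Finset.insert_subset hpT (hS'T.trans (Finset.erase_subset _ _))
    · intro c hc
      rcases Finset.mem_insert.1 hc with rfl | hc
      · simp only [if_true, hAp]
        exact W.sub_mem hw₀ (W.sum_mem fun c hc => W.smul_mem _ (hW'le (hA'W c hc)))
      · simp only [show c ≠ p from fun h => hpS' (h ▸ hc), if_false]; exact hW'le (hA'W c hc)
    · intro c hc
      rcases Finset.mem_insert.1 hc with rfl | hc
      · simp only [if_true, hAp, Pi.sub_apply, Finset.sum_apply, Pi.smul_apply, smul_eq_mul]
        rw [hw₀p, Finset.sum_eq_zero (fun c' hc' => by rw [hW'p _ (hA'W c' hc'), mul_zero]),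
          sub_zero]
      · simp only [show c ≠ p from fun h => hpS' (h ▸ hc), if_false]; exact hA'1 c hc
    · intro c hc c' hc' hne
      rcases Finset.mem_insert.1 hc with rfl | hc
      · -- `Ap c' = 0` for `c' ∈ S'`
        have hc'S : c' ∈ S' := (Finset.mem_insert.1 hc').resolve_left hne
        simp only [if_true, hAp, Pi.sub_apply, Finset.sum_apply, Pi.smul_apply, smul_eq_mul]
        rw [Finset.sum_eq_single c' (fun b hb hbc => by rw [hA'0 b hb c' hc'S (Ne.symm hbc), mul_zero])
          (fun h => absurd hc'S h), hA'1 c' hc'S, mul_one, sub_self]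
      · simp only [show c ≠ p from fun h => hpS' (h ▸ hc), if_false]
        rcases Finset.mem_insert.1 hc' with rfl | hc'
        · exact hW'p _ (hA'W c hc)
        · exact hA'0 c hc c' hc' hne
    · intro c hc q hq
      rcases Finset.mem_insert.1 hc with rfl | hc
      · simp only [if_true, hAp, Pi.sub_apply, Finset.sum_apply, Pi.smul_apply, smul_eq_mul]
        rw [hbelow w₀ hw₀ q hq,
          Finset.sum_eq_zero (fun c' hc' => by rw [hbelow _ (hW'le (hA'W c' hc')) q hq, mul_zero]),
          sub_zero]
      · simp only [show c ≠ p from fun h => hpS' (h ▸ hc), if_false]; exact hA'lt c hc q hq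
    · intro w hw
      -- `w - w p • w₀ ∈ W'`
      have hw' : w - w p • w₀ ∈ W' := Submodule.mem_inf.2 ⟨W.sub_mem hw (W.smul_mem _ hw₀), by
        rw [LinearMap.mem_ker, LinearMap.proj_apply]; simp [hw₀p]⟩
      have hrep' : w - w p • w₀ = ∑ c ∈ S', (w c - w p * w₀ c) • A' c := by
        refine (hA'rep _ hw').trans (Finset.sum_congr rfl fun c _ => ?_)
        simp only [Pi.sub_apply, Pi.smul_apply, smul_eq_mul]
      rw [Finset.sum_insert hpS']
      dsimp only
      rw [if_pos rfl]
      have hsum : (∑ c ∈ S', w c • (if c = p then Ap else A' c)) = ∑ c ∈ S', w c • A' c :=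
        Finset.sum_congr rfl fun c hc => by simp only [show c ≠ p from fun h => hpS' (h ▸ hc), if_false]
      rw [hsum, hAp, smul_sub, Finset.smul_sum]
      have hsplit : (∑ c ∈ S', (w c - w p * w₀ c) • A' c) =
          ∑ c ∈ S', w c • A' c - ∑ c ∈ S', w p • (w₀ c • A' c) := by
        rw [← Finset.sum_sub_distrib]
        refine Finset.sum_congr rfl fun c _ => ?_
        rw [sub_smul, smul_smul]
      calc w = (w - w p • w₀) + w p • w₀ := by abel
        _ = (∑ c ∈ S', w c • A' c - ∑ c ∈ S', w p • (w₀ c • A' c)) + w p • w₀ := by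
          rw [hrep', hsplit]
        _ = w p • w₀ - ∑ c ∈ S', w p • (w₀ c • A' c) + ∑ c ∈ S', w c • A' c := by abel

/-- **Reduced echelon basis** of a subspace of `K^ι` (`ι` a finite linear order): leading cells
`S` and vectors `A_c ∈ W` with `A_c(c) = 1`, `A_c(c') = 0` (`c' ∈ S`, `c' ≠ c`), `A_c(p) = 0`
(`p < c`), and `w = Σ_{c∈S} w(c) A_c` for all `w ∈ W`; moreover `|S| = dim W`. [folklore] -/
theorem exists_echelon_basis [Fintype ι] (W : Submodule K (ι → K)) :
    ∃ (S : Finset ι) (A : ι → (ι → K)), (∀ c ∈ S, A c ∈ W) ∧ (∀ c ∈ S, A c c = 1) ∧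
      (∀ c ∈ S, ∀ c' ∈ S, c' ≠ c → A c c' = 0) ∧ (∀ c ∈ S, ∀ p, p < c → A c p = 0) ∧
      (∀ w ∈ W, w = ∑ c ∈ S, w c • A c) ∧ S.card = Module.finrank K W := by
  classical
  obtain ⟨S, A, -, hAW, hA1, hA0, hAlt, hrep⟩ :=
    exists_echelon_basis_of_support (K := K) Finset.univ W (fun w _ q hq => absurd (Finset.mem_univ q) hq)
  refine ⟨S, A, hAW, hA1, hA0, hAlt, hrep, ?_⟩
  -- the `A_c`, `c ∈ S`, form a basis of `W`
  have hli : LinearIndependent K (fun c : S => (⟨A c, hAW c c.2⟩ : W)) := by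
    rw [Fintype.linearIndependent_iff]
    intro g hg c
    have h := congrArg (fun v : W => (v : ι → K) c) hg
    simp only [Submodule.coe_sum, Submodule.coe_smul, Finset.sum_apply, Pi.smul_apply,
      smul_eq_mul, Submodule.coe_zero, Pi.zero_apply] at h
    rw [Finset.sum_eq_single c (fun b _ hbc => by
      rw [hA0 b b.2 c c.2 (fun h' => hbc (Subtype.ext h'.symm)), mul_zero])
      (fun h' => absurd (Finset.mem_univ c) h'), hA1 c c.2, mul_one] at h
    exact h
  have hsp : ⊤ ≤ Submodule.span K (Set.range fun c : S => (⟨A c, hAW c c.2⟩ : W)) := by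
    rintro ⟨w, hw⟩ -
    have : (⟨w, hw⟩ : W) = ∑ c : S, w c • (⟨A c, hAW c c.2⟩ : W) := by
      apply Subtype.ext
      simp only [Submodule.coe_sum, Submodule.coe_smul]
      calc w = ∑ c ∈ S, w c • A c := hrep w hw
        _ = ∑ c : S, w c • A c := (Finset.sum_coe_sort S (fun c => w c • A c)).symm
    rw [this]
    exact Submodule.sum_mem _ fun c _ => Submodule.smul_mem _ _ (Submodule.subset_span ⟨c, rfl⟩)
  let b : Module.Basis S K W := Module.Basis.mk hli hsp
  rw [Module.finrank_eq_card_basis b, Fintype.card_coe]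

end Summit.ValiantsHypothesis.LiftNullstellensatz
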